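/-
Copyright (c) 2026. All rights reserved.
Released under Apache 2.0 license as described in the file LICENSE.
Authors: abc-iut cell, prover seat abc-iut-L4-t15 (gen 10).
-/
import Literature.IUT.HodgeTheaters.PuncturedEllipticGeomOriginProfiniteModel
import HarnessLib

/-!
# [IUTchI] §1: the profinite datum `D₀` (profinite completion of `F₂ ⋊ ℤ/2`) WITH ITS ELLIPTIC INVOLUTION
# `ι = η(σ)` — the clauses of abc-iut-L5-t1's `GeomOriginIota` inhabited at `D₀`

Mochizuki, *Inter-universal Teichmüller theory I*, §1 p. 37 ("`C` … the quotient of `X` by the unique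
`k`-involution `−1`") [cite: Mochizuki2012, IUTchI §1 p.37] (D-0012 claim key; nothing of the disputed series is
asserted); [EtTh] Def. 2.1 p. 33 (`Δ_C = Δ_X ⋊ ⟨ι⟩`).  PROOF-ONLY sequel (0 definitions, 0 named facts; cell
abc-iut, seat abc-iut-L4-t15 gen 10; L5 rows R47 «GEOMORIGIN-NV@PROFINITE» ✓ p500503/p500947 and R46
«GEOMORIGIN-IOTA-FIELD» (abc-iut-L5-t1, record `GeomOriginIota D extends GeomOrigin D` with fields `iota ∈ Δ_C`,
`iota ∉ Π_X`, `iota² = 1`, `iota·gensᵢ·iota⁻¹ = gensᵢ⁻¹`, in the DEFS review lane at the time of writing)).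

* **`PuncturedEllipticData.exists_geomOrigin_involution`** — at the datum `D₀` of the companion file
  (`Π_C = Ŵ`, `W = F₂ ⋊[φ] ℤ/2`, `G_k = Gal(ℚ̄/ℚ̄)`, `Π_X = Ker(Ŵ ↠ ℤ/2)`), re-run here verbatim (a proof-only
  file cannot export the datum as a term), there are a record `O : D₀.GeomOrigin` (gens `η a, η b`) AND an element
  `ι := η(σ) ∈ Π_C` with: `ι ∈ Δ_C` (`= Π_C`), `ι ∉ Π_X` (`σ ∉ F₂ = Ker(W ↠ ℤ/2)`), `ι² = 1` (`σ² = 1`), and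
  **`ι·η(xᵢ)·ι⁻¹ = η(xᵢ)⁻¹`** for both free letters (`SemidirectProduct.inl_aut`: `inl (φ σ x) = σ·inl x·σ⁻¹` and
  `φ σ xᵢ = xᵢ⁻¹`) — i.e. EXACTLY the four ι-clauses of `GeomOriginIota`, together with cusp rationality (r),
  `Subsingleton D.E.gal`, `[Π_C : Π_X] = 2` and `Π_C ≃ₜ* Ŵ`.  When the record `GeomOriginIota` is in the tree its
  inhabitant at `D₀` is the anonymous constructor applied to these witnesses (one line, any seat).

HONEST LABEL as in the companion: a group-theoretic model (profinite completion of the TOPOLOGICAL orbifold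
`π₁` of `C = X/{±1}` over an algebraically closed base), not an étale `π₁`; NV evidence for the record types only;
nothing here bears on [IUTchIII] Cor. 3.12; inhabited ≠ endorsed; no side taken.
-/

noncomputable section

open CategoryTheory Topology ProfiniteGrp

namespace Literature.IUT.HodgeTheaters

open GeomOriginProfiniteModel Literature.AnabelianGeometry.AbsoluteAnabelian
  Literature.IUT.HodgeTheaters.ProfiniteCompletion

/-- Over an algebraically closed field the absolute Galois group is trivial. [folklore] -/
private theorem subsingleton_absoluteGaloisGroup_model' (k : Type) [Field k] [IsAlgClosed k] :
    Subsingleton (Field.absoluteGaloisGroup k) := by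
  refine ⟨fun σ τ => AlgEquiv.ext fun x => ?_⟩
  obtain ⟨a, rfl⟩ :=
    (IsAlgClosed.algebraMap_bijective_of_isIntegral (k := k) (K := AlgebraicClosure k)).2 x
  rw [AlgEquiv.commutes, AlgEquiv.commutes]

/-- For an extension whose Galois group is trivial, `Δ = Π`. [folklore] -/
private theorem geom_eq_top_of_subsingleton_model' (E : FundamentalExtension.{0}) [Subsingleton E.gal] :
    E.geom = ⊤ := by
  rw [eq_top_iff]
  intro x _
  rw [FundamentalExtension.mem_geom]
  exact Subsingleton.elim _ _

/-- **The profinite datum with its elliptic involution** (clauses of abc-iut-L5-t1's `GeomOriginIota` at `D₀`):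
there are `D : PuncturedEllipticData`, a record `O : D.GeomOrigin` and `ι ∈ Δ_C ∖ Π_X` with `ι² = 1` and
`ι·gensᵢ·ι⁻¹ = gensᵢ⁻¹` (`i = 0, 1`); moreover every cusp decomposition group surjects onto `G_k`, `G_k` is a
point, `[Π_C : Π_X] = 2`, and `Π_C ≃ₜ* Ŵ`, `W = F₂ ⋊ ℤ/2`. [cite: Mochizuki2012, IUTchI §1 p.37] -/
theorem PuncturedEllipticData.exists_geomOrigin_involution :
    ∃ (D : PuncturedEllipticData.{0}) (O : D.GeomOrigin) (ι : D.PiC),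
      ι ∈ D.DeltaC ∧ ι ∉ D.PiX ∧ ι * ι = 1 ∧
      (∀ i : Fin 2, ι * (O.gens i : D.PiC) * ι⁻¹ = ((O.gens i : D.PiC))⁻¹) ∧
      (∀ x : D.Cusp, Function.Surjective (D.E.aug.toMonoidHom.comp (D.decomp x).subtype)) ∧
      Subsingleton D.E.gal ∧ D.PiX.index = 2 ∧
      Nonempty (D.PiC ≃ₜ* profiniteCompletion
        (FreeGroup (Fin 2) ⋊[Classical.choose GeomOriginProfiniteModel.exists_inversionAction]
          Multiplicative (ZMod 2))) := by
  classical
  -- the inversion action and the orbifold group `W`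
  set φ := Classical.choose exists_inversionAction with hφdef
  have hφ : ∀ a : Fin 2, φ (Multiplicative.ofAdd 1) (FreeGroup.of a) = (FreeGroup.of a)⁻¹ :=
    Classical.choose_spec exists_inversionAction
  haveI hnormal := normal_range_inl φ
  have hindex := index_range_inl φ
  haveI hfi : (SemidirectProduct.inl : FreeGroup (Fin 2) →*
      FreeGroup (Fin 2) ⋊[φ] Multiplicative (ZMod 2)).range.FiniteIndex := ⟨by rw [hindex]; norm_num⟩
  -- the open index-2 subgroup `Π_X = Ker(Ŵ ↠ ℤ/2)`
  obtain ⟨K, hKo, hKi, hK⟩ := exists_open_subgroup_of_finiteIndex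
    (W := FreeGroup (Fin 2) ⋊[φ] Multiplicative (ZMod 2)) SemidirectProduct.inl.range
  have hKc : IsClosed (K : Set (profiniteCompletion (FreeGroup (Fin 2) ⋊[φ] Multiplicative (ZMod 2)))) :=
    K.isClosed_of_isOpen hKo
  -- the extension `Π_C ↠ G_k` with `G_k = Gal(ℚ̄/ℚ̄) = 1`
  haveI : Subsingleton (Field.absoluteGaloisGroup (AlgebraicClosure ℚ)) :=
    subsingleton_absoluteGaloisGroup_model' _
  let E : FundamentalExtension.{0} :=
    { arith := profiniteCompletion (FreeGroup (Fin 2) ⋊[φ] Multiplicative (ZMod 2))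
      gal := absoluteGaloisGrp (AlgebraicClosure ℚ)
      aug := 1
      aug_surjective := fun _ => ⟨1, Subsingleton.elim _ _⟩ }
  have hEgeom : E.geom = ⊤ := geom_eq_top_of_subsingleton_model' E
  have hKg : K ⊓ E.geom = K := by rw [hEgeom, inf_top_eq]
  -- the corestriction `j : F₂ → Π_X ∩ Δ_C = Π_X`
  have hmem : ∀ x : FreeGroup (Fin 2),
      (toCompletion (FreeGroup (Fin 2) ⋊[φ] Multiplicative (ZMod 2))).comp SemidirectProduct.inl x ∈ K ⊓ E.geom := by
    intro x
    rw [hKg]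
    exact (hK _).2 ⟨x, rfl⟩
  have hKo' : IsOpen ((K ⊓ E.geom : Subgroup _) : Set (profiniteCompletion (FreeGroup (Fin 2) ⋊[φ] Multiplicative (ZMod 2)))) := by
    rw [hKg]; exact hKo
  have hK' : ∀ w : FreeGroup (Fin 2) ⋊[φ] Multiplicative (ZMod 2),
      toCompletion _ w ∈ K ⊓ E.geom ↔ w ∈ (SemidirectProduct.inl : FreeGroup (Fin 2) →* _).range := by
    intro w; rw [hKg]; exact hK w
  let j : FreeGroup (Fin 2) →* ↥(K ⊓ E.geom) :=
    ((toCompletion (FreeGroup (Fin 2) ⋊[φ] Multiplicative (ZMod 2))).comp SemidirectProduct.inl).codRestrict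
      (K ⊓ E.geom) hmem
  have hfree : IsFreeProOn ↥(K ⊓ E.geom) Set.univ (fun a : Fin 2 => j (FreeGroup.of a)) :=
    isFreeProOn_univ_of_prime
      (isFreeProOn_codRestrict SemidirectProduct.inl SemidirectProduct.inl_injective (K ⊓ E.geom) hKo' hK' hmem)
  -- the cusp inertia `⟨η[a,b]⟩⁻`
  let c : profiniteCompletion (FreeGroup (Fin 2) ⋊[φ] Multiplicative (ZMod 2)) :=
    (j (FreeGroup.of 0) : profiniteCompletion (FreeGroup (Fin 2) ⋊[φ] Multiplicative (ZMod 2))) *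
      (j (FreeGroup.of 1)) * (j (FreeGroup.of 0))⁻¹ * (j (FreeGroup.of 1))⁻¹
  have hcK : c ∈ K := by
    have h0 : (j (FreeGroup.of 0) : profiniteCompletion (FreeGroup (Fin 2) ⋊[φ] Multiplicative (ZMod 2))) ∈ K :=
      (hmem (FreeGroup.of 0)).1
    have h1 : (j (FreeGroup.of 1) : profiniteCompletion (FreeGroup (Fin 2) ⋊[φ] Multiplicative (ZMod 2))) ∈ K :=
      (hmem (FreeGroup.of 1)).1
    exact K.mul_mem (K.mul_mem (K.mul_mem h0 h1) (K.inv_mem h0)) (K.inv_mem h1)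
  have hIle : (Subgroup.zpowers c).topologicalClosure ≤ K :=
    Subgroup.topologicalClosure_minimal _ ((Subgroup.zpowers_le).mpr hcK) hKc
  -- the datum
  let D : PuncturedEllipticData.{0} :=
    { l := 5
      five_le := le_rfl
      coprime_six := by decide
      E := E
      PiX := K
      PiCbar := ⊤
      isOpen_piX := hKo
      isOpen_piCbar := isOpen_univ
      index_piX := by rw [hKi, hindex]
      aug_piX := fun _ => ⟨1, Subsingleton.elim _ _⟩
      aug_piCbar := fun _ => ⟨1, Subsingleton.elim _ _⟩
      star := by
        intro g hg x hx
        have hg' : g ∈ K ⊓ E.geom := by rw [hKg]; exact hg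
        exact Subgroup.le_topologicalClosure _
          (Subgroup.mem_sup_left (Subgroup.commutator_mem_commutator hg' hx))
      Cusp := Fin 4
      decomp := fun _ => (Subgroup.zpowers c).topologicalClosure
      decomp_le := fun _ => le_inf hIle le_top
      ε0 := 0
      ε1 := 1
      ε2 := 2
      twoε := 3
      ε1_ne_ε0 := by decide
      ε2_ne_ε0 := by decide
      ε1_ne_ε2 := by decide
      twoε_ne := by decide
      aug_decomp_twoε := fun _ => ⟨1, Subsingleton.elim _ _⟩ }
  have hDgeom : D.DeltaC = ⊤ := hEgeom
  -- the record
  -- the involution `ι = η(σ)`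
  let ι : profiniteCompletion (FreeGroup (Fin 2) ⋊[φ] Multiplicative (ZMod 2)) :=
    toCompletion _ (SemidirectProduct.inr (Multiplicative.ofAdd 1))
  have h11 : Multiplicative.ofAdd (1 : ZMod 2) * Multiplicative.ofAdd (1 : ZMod 2) = 1 := by decide
  have hσ1 : (Multiplicative.ofAdd (1 : ZMod 2)) ≠ 1 := by decide
  have hιK : ι ∉ K := by
    intro h
    have h' := (hK _).1 h
    rw [SemidirectProduct.range_inl_eq_ker_rightHom, MonoidHom.mem_ker, SemidirectProduct.rightHom_inr] at h'
    exact hσ1 h'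
  have hιι : ι * ι = 1 := by
    change toCompletion _ _ * toCompletion _ _ = 1
    rw [← map_mul, ← map_mul, h11, map_one, map_one]
  have hιgens : ∀ i : Fin 2, ι * (j (FreeGroup.of i) : profiniteCompletion (FreeGroup (Fin 2) ⋊[φ] Multiplicative (ZMod 2))) * ι⁻¹ =
      ((j (FreeGroup.of i) : profiniteCompletion (FreeGroup (Fin 2) ⋊[φ] Multiplicative (ZMod 2))))⁻¹ := by
    intro i
    have key : (SemidirectProduct.inr (Multiplicative.ofAdd 1) : FreeGroup (Fin 2) ⋊[φ] Multiplicative (ZMod 2)) *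
        SemidirectProduct.inl (FreeGroup.of i) * (SemidirectProduct.inr (Multiplicative.ofAdd 1))⁻¹ =
        SemidirectProduct.inl ((FreeGroup.of i)⁻¹) := by
      rw [← map_inv SemidirectProduct.inr, ← SemidirectProduct.inl_aut, hφ i]
    change toCompletion _ (SemidirectProduct.inr (Multiplicative.ofAdd 1)) *
        toCompletion _ (SemidirectProduct.inl (FreeGroup.of i)) *
        (toCompletion _ (SemidirectProduct.inr (Multiplicative.ofAdd 1)))⁻¹ =
      (toCompletion _ (SemidirectProduct.inl (FreeGroup.of i)))⁻¹
    rw [← map_inv, ← map_mul, ← map_mul, key, map_inv, map_inv]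
  refine ⟨D, ⟨fun a => j (FreeGroup.of a), hfree, ?_, ?_⟩, ι, ?_, hιK, hιι, hιgens,
    fun _ _ => ⟨1, Subsingleton.elim _ _⟩, ‹_›, ?_, ⟨ContinuousMulEquiv.refl _⟩⟩
  · -- (c′): every cusp inertia is `⟨[a,b]⟩⁻` itself (`g = 1`)
    intro x
    refine ⟨1, Subgroup.one_mem _, ?_⟩
    change (Subgroup.zpowers c).topologicalClosure ⊓ E.geom = (Subgroup.zpowers (1 * c * 1⁻¹)).topologicalClosure
    rw [one_mul, inv_one, mul_one]
    have hle : (Subgroup.zpowers c).topologicalClosure ≤ E.geom := by rw [hEgeom]; exact le_top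
    exact inf_eq_left.mpr hle
  · -- (e): `Δ_C = Ŵ` is topologically generated by torsion: `η(W)` is dense and `W = ⟨σ, aσ, bσ⟩`
    rw [hDgeom]
    intro y _
    have hd : DenseRange (toCompletion (FreeGroup (Fin 2) ⋊[φ] Multiplicative (ZMod 2))) :=
      ProfiniteGrp.ProfiniteCompletion.denseRange (GrpCat.of _)
    have hy : y ∈ closure (Set.range (toCompletion (FreeGroup (Fin 2) ⋊[φ] Multiplicative (ZMod 2)))) := by
      rw [hd.closure_range]; trivial
    refine (Subgroup.isClosed_topologicalClosure _).closure_subset_iff.mpr ?_ hy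
    rintro _ ⟨w, rfl⟩
    have hw : w ∈ Subgroup.closure ({SemidirectProduct.inr (Multiplicative.ofAdd 1),
        SemidirectProduct.inl (FreeGroup.of 0) * SemidirectProduct.inr (Multiplicative.ofAdd 1),
        SemidirectProduct.inl (FreeGroup.of 1) * SemidirectProduct.inr (Multiplicative.ofAdd 1)} :
      Set (FreeGroup (Fin 2) ⋊[φ] Multiplicative (ZMod 2))) := by
      rw [closure_three_eq_top]; trivial
    refine Subgroup.le_topologicalClosure _ ?_
    have hmap := Subgroup.mem_map_of_mem (toCompletion (FreeGroup (Fin 2) ⋊[φ] Multiplicative (ZMod 2))) hw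
    rw [MonoidHom.map_closure] at hmap
    refine Subgroup.closure_mono ?_ hmap
    rintro _ ⟨s, hs, rfl⟩
    refine ⟨Subgroup.mem_top _, ?_⟩
    exact (toCompletion _).isOfFinOrder (isOfFinOrder_three φ hφ s hs)
  · -- `ι ∈ Δ_C = Π_C`
    rw [hDgeom]; exact Subgroup.mem_top _
  · -- `[Π_C : Π_X] = 2`
    change K.index = 2
    rw [hKi, hindex]

end Literature.IUT.HodgeTheaters

end
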